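/-
Copyright (c) 2026 the pub-hodgecm-mathlib formalisation cell (harness21).  Prover seat hodgecm-mathlib-K2E5-p17 (g4), Track B «K2-LIT» ∕ h413
(`stmt-HodgeConjecture-24833`), line `K2_E3_EllipticInputs`, unit U12 «Characters», road «GL-[M6]-sc» (line lead K2E3-p23 (g5), RULINGS #11 (M11-3)
2026-09-04T06:52Z: T20-GL₃), FILE (A): «HARISH-CHANDRA'S THEOREM-20 BOOKKEEPING FOR A FINITE FAMILY OF CONTRACTING DIRECTIONS (HIGHER RANK): THE POLYCHOTOMY
WITH A LEVI DEFECT», abstract group form — the rank-`r` replacement of the rank-one dichotomy `A = A⁺ ∪ A⁻` of ★ (T20-e2).  2026-09-04.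
-/
import Summits.HodgeConjecture.HodgeConjecture.Theorems.K2E3CuspFormCancellationCore     -- ★ (T20-e1) K2E3-p14 (g3): Lemma 57 ∘ Lemma 53 `setIntegral_mul_eq_zero_of_cuspForm`, `…_of_forall_eq_zero`; brings ★ (T20-e2) Heights
import HarnessLib

/-!
# K2_E3 road (h413), U12 «Characters» — Theorem 20 in higher rank, abstract part: the POLYCHOTOMY (finitely many contracting directions, each with its own
# triple `(T_c, U_c, V_c)` and a LEVI DEFECT `D_c`), and the resulting cancellation `∫_{K′} f(x y k) dμ = 0`

Cell `pub/hodgecm-mathlib` (D-0151), Track B, seat K2E5-p17 (g4); line lead K2E3-p23 (g5), co-owner of T20-GL₃ K2E3-p21 (g5), dealer K2E3-plan (g3).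
`--supports stmt-HodgeConjecture-24833 --as helper`; THEOREMS ONLY (no definition ∕ instance ∕ notation ∕ named fact ∕ `sorry`); never imports `Cruxes/…/Lines`.
COUNT-NEUTRAL.  Consumer: FILE (B)∕(C) `K2E3GL3CuspFormCancellation{Inputs,}` (Theorem 20 for `GL₃(F)`: six Weyl chambers × three regimes).

WHY.  ★ (T20-e2) `K2E3CuspFormCancellationHeights.cuspForm_trichotomy_of_not_mem_heightBall` is the RANK-ONE shape of [HarishChandra1970, VII §8]: the support torus
`A` is covered by `A⁺ ∪ A⁻`, an element `a ∈ A⁺` far from `1` contracts the FULL radical `N`, and `a` normalises `K₀ ∩ T` INTO `K₀`.  In rank `≥ 2` (e.g. the diagonal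
torus of `GL₃`) an element far from `1` contracts only the radical `U_F` of the parabolic `P_F` attached to the simple roots that are LARGE on it, and on the Levi
`M_F ⊇ T` it acts with a bounded but non-trivial DEFECT (`a (K₀ ∩ M_F) a⁻¹ ⊆ Ω D`, `D` = the size of the SMALL roots).  Both features are absorbed by print's own
argument with shifted constants: `γ₀ = γ (v t)^a ∈ Ω (m_C + D)` instead of `Ω m_C`, Lemma 54 then puts `a u a⁻¹ ∈ Ω (4 m_C + 2 D)`, and the contraction must reach the
deep level from height `4 m_C + 2 D`.
* §1 **`exists_eq_mul_and_forall_mem_of_contracting_defect`** — ★ (T20-e2) §1 with the Levi defect `D` (`D = 0`, `Ω 0 ⊇ K₀` recovers it).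
* §2 **`cuspForm_polychotomy_of_not_mem_heightBall`** — data: a family `c ↦ (T_c, U_c, V_c, D_c)` of Iwahori triples and defects and a family of PIECES `P_c ⊆ G`
  covering the far part of `A` (`a ∈ A`, `a ∉ Ω R ⇒ ∃ c, a ∈ P_c`), each piece conjugating `K₀ ∩ V_c` into `K₀`, `K₀ ∩ T_c` into `Ω D_c`, normalising `U_c` and
  contracting `U_c ∩ Ω k` into `L j` whenever `j + k ≤ j₀ + 4 m_C + 2 D_c + 1`; conclusion for `y ∈ Ω s`, `x ∉ Ω (m_C + R + s)`: EITHER `x y k ∉ S` for all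
  `k ∈ K′`, OR for SOME `c` every `k ∈ K′` has `x y k = g₀ u₀` (`u₀ ∈ U_c`) with `g₀ u ∈ S ⇒ u ∈ K′` on `U_c` — the input of ★ (T20-e1) along `U_c`.
  `cuspForm_polychotomy_support`, `cuspForm_polychotomy_conjLevel` (readings: `S = {f ≠ 0}`; `K′ = K₀ ∩ y⁻¹K₀y`, `j₀ = m + 2s`).
* §3 **`setIntegral_mul_eq_zero_of_polychotomy`**, **`…_haar`**, **`cuspForm_cancellation_polychotomy_conjLevel`** — with `U_c` closed carrying left Haar measures
  `ν_c` and `f` continuous, a cusp form along EVERY `U_c`: `∫_{k ∈ K′} f(x y k) dμ = 0` (★ (T20-e1) `setIntegral_mul_eq_zero_of_cuspForm` in the case that occurs).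
[HarishChandra1970, Part VII §2 Thm. 20 p. 70, §8 Lemmas 53–57 pp. 80–84 (the general-rank proof: `P = P_F`, `a ∈ A_F^+`)]; [Casselman1995, Prop. 1.4.3–1.4.4].

HONEST LABEL: HC_CM is proved only modulo the 7 printed citations (2 remaining named inputs: hLiu418 = stmt-HodgeConjecture-24832, h413 = stmt-HodgeConjecture-24833)
until rung 0 closes; count-neutral helper (abstract bookkeeping; nothing printed is asserted).
-/

set_option autoImplicit false
set_option linter.dupNamespace false   -- `Summit.HodgeConjecture.HodgeConjecture.…` (D-0017 nested layout; lakefile exemption for Summits)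

noncomputable section

open MeasureTheory MeasureTheory.Measure Topology Set
open scoped Pointwise ENNReal
open Summit.HodgeConjecture.HodgeConjecture.Cruxes.H413.K2E3CuspFormCancellationHeights
open Summit.HodgeConjecture.HodgeConjecture.Cruxes.H413.K2E3CuspFormCancellationCore

namespace Summit.HodgeConjecture.HodgeConjecture.Cruxes.H413.K2E3CuspFormCancellationPolychotomy

/-! ## §1 One-sided Lemmas 54–56 with a Levi defect -/

section Algebra

variable {G : Type*} [Group G]

/-- **LEMMAS 54–56, ONE-SIDED, WITH A LEVI DEFECT `D`.**  As ★ `exists_eq_mul_and_forall_mem_of_contracting`, but the fixed element `a` is only required to conjugate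
`K₀ ∩ T` into the height ball `Ω D` (not into `K₀`); in exchange the contraction must reach the deep level `L j₀` from height `4 m_C + 2 D`
(`j₀ + 4 m_C + 2 D ≤ h + 1`).  If `xy = γ a k₀` (`γ ∈ C`, `k₀ ∈ K′`) then every `k ∈ K′` has `xy·k = g₀·u₀` (`u₀ ∈ U`) with `g₀ u ∈ S ⇒ u ∈ K′` on `U`.
Print: `γ₀ = γ (v t)^a ∈ Ω (m_C + D)`; `g₀ u ∈ C A ⇒ (a u a⁻¹)(a a′⁻¹) ∈ γ₀⁻¹ C ⊆ Ω (2m_C + D)`, Lemma 54: `a u a⁻¹ ∈ Ω (4m_C + 2D)`, contraction: `u ∈ L j₀ ⊆ K′`.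
[cite: HarishChandra1970, Part VII §8 Lemmas 54–56 pp. 82–83] [cite: Casselman1995, Prop. 1.4.3–1.4.4] -/
theorem exists_eq_mul_and_forall_mem_of_contracting_defect (Ω : ℕ → Set G)
    (hΩmul : ∀ {a b : ℕ} {g g' : G}, g ∈ Ω a → g' ∈ Ω b → g * g' ∈ Ω (a + b)) (hΩinv : ∀ {a : ℕ} {g : G}, g ∈ Ω a → g⁻¹ ∈ Ω a)
    (K₀ K' T U V A : Subgroup G) (L : ℕ → Subgroup G) (hK₀ : (K₀ : Set G) ⊆ Ω 0) (hK' : K' ≤ K₀) {j₀ : ℕ} (hL : L j₀ ≤ K')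
    (S C : Set G) {mC : ℕ} (hC : C ⊆ Ω mC) (hS : S ⊆ C * (A : Set G))
    (h54 : ∀ u ∈ U, ∀ a' ∈ A, ∀ c : ℕ, u * a' ∈ Ω c → u ∈ Ω (2 * c))
    (hIw : ∀ k ∈ K₀, ∃ v ∈ K₀ ⊓ V, ∃ t ∈ K₀ ⊓ T, ∃ u ∈ K₀ ⊓ U, k = v * t * u)
    {a : G} (haA : a ∈ A) {D h : ℕ} (hj : j₀ + (4 * mC + 2 * D) ≤ h + 1)
    (hcV : ∀ v ∈ K₀ ⊓ V, a * v * a⁻¹ ∈ K₀) (hcT : ∀ t ∈ K₀ ⊓ T, a * t * a⁻¹ ∈ Ω D) (hnormU : ∀ u ∈ U, a * u * a⁻¹ ∈ U)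
    (hcontr : ∀ (c j : ℕ), j + c ≤ h + 1 → ∀ u ∈ U, u ∈ Ω c → a⁻¹ * u * a ∈ L j)
    {z γ k₀ : G} (hγ : γ ∈ C) (hk₀ : k₀ ∈ K') (hz : z = γ * a * k₀) :
    ∀ k ∈ K', ∃ g₀ : G, ∃ u₀ ∈ U, z * k = g₀ * u₀ ∧ ∀ u ∈ U, g₀ * u ∈ S → u ∈ K' := by
  intro k hk
  obtain ⟨v, hv, t, ht, u, hu, hfac⟩ := hIw _ (hK' (K'.mul_mem hk₀ hk))
  refine ⟨γ * (a * (v * t) * a⁻¹) * a, u, (Subgroup.mem_inf.1 hu).2, ?_, ?_⟩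
  · rw [hz, mul_assoc (γ * a) k₀ k, hfac]; group
  · intro u' hu' hS'
    obtain ⟨c', hc', a', ha', heq⟩ := Set.mem_mul.1 (hS hS')
    -- `γ₀ := γ (a v t a⁻¹) ∈ Ω (m_C + D)`
    have hvt : a * (v * t) * a⁻¹ ∈ Ω D := by
      have e : a * (v * t) * a⁻¹ = (a * v * a⁻¹) * (a * t * a⁻¹) := by group
      have h1 := hΩmul (hK₀ (hcV v hv)) (hcT t ht)
      rw [zero_add] at h1
      rw [e]; exact h1
    have hγ₀ : γ * (a * (v * t) * a⁻¹) ∈ Ω (mC + D) := hΩmul (hC hγ) hvt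
    -- `(a u' a⁻¹)(a a'⁻¹) = γ₀⁻¹ c' ∈ Ω (2m_C + D)`
    have hw : a * u' * a⁻¹ ∈ U := hnormU u' hu'
    have hid : (a * u' * a⁻¹) * (a * a'⁻¹) = (γ * (a * (v * t) * a⁻¹))⁻¹ * c' := by
      rw [eq_mul_inv_of_mul_eq heq]; group
    have h2 : (a * u' * a⁻¹) * (a * a'⁻¹) ∈ Ω (mC + D + mC) := by rw [hid]; exact hΩmul (hΩinv hγ₀) (hC hc')
    -- Lemma 54: `a u' a⁻¹ ∈ Ω (4m_C + 2D)`
    have h3 : a * u' * a⁻¹ ∈ Ω (2 * (mC + D + mC)) := h54 _ hw _ (A.mul_mem haA (A.inv_mem ha')) _ h2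
    have e4 : 2 * (mC + D + mC) = 4 * mC + 2 * D := by ring
    rw [e4] at h3
    -- Lemmas 55–56: contract back into the deep level `L j₀ ≤ K′`
    have h5 : a⁻¹ * (a * u' * a⁻¹) * a ∈ L j₀ := hcontr (4 * mC + 2 * D) j₀ hj _ hw h3
    have e6 : a⁻¹ * (a * u' * a⁻¹) * a = u' := by group
    rw [e6] at h5
    exact hL h5

/-! ## §2 The polychotomy: a finite family of contracting directions -/

/-- **THE POLYCHOTOMY BEHIND THEOREM 20 IN HIGHER RANK** (Lemmas 54–56 for a family of directions).  Data: height balls `Ω`; `K′ ≤ K₀ ⊆ Ω 0` with a deep level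
`L j₀ ≤ K′`; a support `S ⊆ C·A`, `C ⊆ Ω m_C`; an index type `ι` of DIRECTIONS, each with an Iwahori triple `K₀ = (K₀∩V_c)(K₀∩T_c)(K₀∩U_c)`, Lemma 54's input on
`U_c`, a Levi defect `D_c` and a PIECE `P_c ⊆ G` of elements conjugating `K₀∩V_c` into `K₀`, `K₀∩T_c` into `Ω D_c`, normalising `U_c` and contracting
`U_c ∩ Ω k` into `L j` for `j + k ≤ j₀ + 4m_C + 2D_c + 1`; and a radius `R` beyond which `A` is covered by the pieces.  THEN for `y ∈ Ω s` and
`x ∉ Ω (m_C + R + s)`: EITHER `x y k ∉ S` for every `k ∈ K′`, OR for some direction `c` every `k ∈ K′` has `x y k = g₀ u₀` (`u₀ ∈ U_c`) with `g₀ u ∈ S ⇒ u ∈ K′` on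
`U_c`.  Proof: if `x y k₁ ∈ S` then `x y = γ a k₁⁻¹` with `a ∈ A`, `a ∉ Ω R` (Lemma 56 ★ `mem_heightBall_of_eq_mul_mul_mul`), pick the direction of `a`, apply §1.
[cite: HarishChandra1970, Part VII §8 pp. 80–84, Lemmas 54–57] [cite: Casselman1995, Prop. 1.4.3–1.4.4] -/
theorem cuspForm_polychotomy_of_not_mem_heightBall {ι : Type*} (Ω : ℕ → Set G)
    (hΩmul : ∀ {a b : ℕ} {g g' : G}, g ∈ Ω a → g' ∈ Ω b → g * g' ∈ Ω (a + b)) (hΩinv : ∀ {a : ℕ} {g : G}, g ∈ Ω a → g⁻¹ ∈ Ω a)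
    (K₀ K' A : Subgroup G) (T U V : ι → Subgroup G) (P : ι → Set G) (D : ι → ℕ) (L : ℕ → Subgroup G)
    (hK₀ : (K₀ : Set G) ⊆ Ω 0) (hK' : K' ≤ K₀) {j₀ : ℕ} (hL : L j₀ ≤ K')
    (S C : Set G) {mC : ℕ} (hC : C ⊆ Ω mC) (hS : S ⊆ C * (A : Set G)) {R : ℕ}
    (hcover : ∀ a ∈ A, a ∉ Ω R → ∃ c, a ∈ P c)
    (hIw : ∀ c, ∀ k ∈ K₀, ∃ v ∈ K₀ ⊓ V c, ∃ t ∈ K₀ ⊓ T c, ∃ u ∈ K₀ ⊓ U c, k = v * t * u)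
    (h54 : ∀ c, ∀ u ∈ U c, ∀ a' ∈ A, ∀ k : ℕ, u * a' ∈ Ω k → u ∈ Ω (2 * k))
    (hV : ∀ c, ∀ a ∈ P c, ∀ v ∈ K₀ ⊓ V c, a * v * a⁻¹ ∈ K₀)
    (hT : ∀ c, ∀ a ∈ P c, ∀ t ∈ K₀ ⊓ T c, a * t * a⁻¹ ∈ Ω (D c))
    (hnormU : ∀ c, ∀ a ∈ P c, ∀ u ∈ U c, a * u * a⁻¹ ∈ U c)
    (hcontr : ∀ c, ∀ a ∈ P c, ∀ (k j : ℕ), j + k ≤ j₀ + (4 * mC + 2 * D c) + 1 → ∀ u ∈ U c, u ∈ Ω k → a⁻¹ * u * a ∈ L j)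
    {s : ℕ} {x y : G} (hy : y ∈ Ω s) (hx : x ∉ Ω (mC + R + s)) :
    (∀ k ∈ K', x * y * k ∉ S) ∨
      ∃ c, ∀ k ∈ K', ∃ g₀ : G, ∃ u₀ ∈ U c, x * y * k = g₀ * u₀ ∧ ∀ u ∈ U c, g₀ * u ∈ S → u ∈ K' := by
  by_cases h0 : ∀ k ∈ K', x * y * k ∉ S
  · exact Or.inl h0
  push Not at h0
  obtain ⟨k₁, hk₁, hk₁S⟩ := h0
  obtain ⟨γ, hγ, a, ha, heq⟩ := Set.mem_mul.1 (hS hk₁S)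
  -- `x y = γ a k₁⁻¹`, `k₀ := k₁⁻¹ ∈ K′`
  have hz : x * y = γ * a * k₁⁻¹ := by rw [heq]; group
  have hk₀ : k₁⁻¹ ∈ K' := K'.inv_mem hk₁
  -- Lemma 56: `a ∉ Ω R`
  have haR : a ∉ Ω R := by
    intro haR
    exact hx (mem_heightBall_of_eq_mul_mul_mul Ω hΩmul hΩinv (hC hγ) haR (hK₀ (hK' hk₀)) hy (by rw [← hz]; group))
  obtain ⟨c, hc⟩ := hcover a ha haR
  exact Or.inr ⟨c, exists_eq_mul_and_forall_mem_of_contracting_defect Ω hΩmul hΩinv K₀ K' (T c) (U c) (V c) A L hK₀ hK' hL S C hC hS (h54 c) (hIw c) ha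
    (Nat.le_succ _) (hV c a hc) (hT c a hc) (hnormU c a hc) (fun k j hkj u hu huk => hcontr c a hc k j hkj u hu huk) hγ hk₀ hz⟩

/-- **THE POLYCHOTOMY FOR A FUNCTION** `f : G → β` (`S := {f ≠ 0}`, `supp f ⊆ C·A`): either `f(x y k) = 0` on `K′`, or for some direction `c` every `k ∈ K′` has
`x y k = g₀ u₀` (`u₀ ∈ U_c`) with `f(g₀ u) ≠ 0 ⇒ u ∈ K′` on `U_c`. [cite: HarishChandra1970, Part VII §8 pp. 80–84, Lemmas 54–57] -/
theorem cuspForm_polychotomy_support {ι β : Type*} [Zero β] (Ω : ℕ → Set G)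
    (hΩmul : ∀ {a b : ℕ} {g g' : G}, g ∈ Ω a → g' ∈ Ω b → g * g' ∈ Ω (a + b)) (hΩinv : ∀ {a : ℕ} {g : G}, g ∈ Ω a → g⁻¹ ∈ Ω a)
    (K₀ K' A : Subgroup G) (T U V : ι → Subgroup G) (P : ι → Set G) (D : ι → ℕ) (L : ℕ → Subgroup G)
    (hK₀ : (K₀ : Set G) ⊆ Ω 0) (hK' : K' ≤ K₀) {j₀ : ℕ} (hL : L j₀ ≤ K')
    (f : G → β) (C : Set G) {mC : ℕ} (hC : C ⊆ Ω mC) (hsupp : ∀ g, f g ≠ 0 → g ∈ C * (A : Set G)) {R : ℕ}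
    (hcover : ∀ a ∈ A, a ∉ Ω R → ∃ c, a ∈ P c)
    (hIw : ∀ c, ∀ k ∈ K₀, ∃ v ∈ K₀ ⊓ V c, ∃ t ∈ K₀ ⊓ T c, ∃ u ∈ K₀ ⊓ U c, k = v * t * u)
    (h54 : ∀ c, ∀ u ∈ U c, ∀ a' ∈ A, ∀ k : ℕ, u * a' ∈ Ω k → u ∈ Ω (2 * k))
    (hV : ∀ c, ∀ a ∈ P c, ∀ v ∈ K₀ ⊓ V c, a * v * a⁻¹ ∈ K₀)
    (hT : ∀ c, ∀ a ∈ P c, ∀ t ∈ K₀ ⊓ T c, a * t * a⁻¹ ∈ Ω (D c))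
    (hnormU : ∀ c, ∀ a ∈ P c, ∀ u ∈ U c, a * u * a⁻¹ ∈ U c)
    (hcontr : ∀ c, ∀ a ∈ P c, ∀ (k j : ℕ), j + k ≤ j₀ + (4 * mC + 2 * D c) + 1 → ∀ u ∈ U c, u ∈ Ω k → a⁻¹ * u * a ∈ L j)
    {s : ℕ} {x y : G} (hy : y ∈ Ω s) (hx : x ∉ Ω (mC + R + s)) :
    (∀ k ∈ K', f (x * y * k) = 0) ∨
      ∃ c, ∀ k ∈ K', ∃ g₀ : G, ∃ u₀ ∈ U c, x * y * k = g₀ * u₀ ∧ ∀ u ∈ U c, f (g₀ * u) ≠ 0 → u ∈ K' := by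
  have hS : {g | f g ≠ 0} ⊆ C * (A : Set G) := fun g hg => hsupp g hg
  rcases cuspForm_polychotomy_of_not_mem_heightBall Ω hΩmul hΩinv K₀ K' A T U V P D L hK₀ hK' hL {g | f g ≠ 0} C hC hS hcover hIw h54 hV hT hnormU hcontr
      hy hx with h | h
  · exact Or.inl fun k hk => by simpa using h k hk
  · exact Or.inr h

end Algebra

/-! ## §3 The cancellation `∫_{K′} f(x y k) dμ = 0` -/

section Measure

variable {G : Type*} [Group G] [TopologicalSpace G] [IsTopologicalGroup G] [MeasurableSpace G] [BorelSpace G]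
  [SecondCountableTopology G] [LocallyCompactSpace G]
  {E : Type*} [NormedAddCommGroup E] [NormedSpace ℝ E]

/-- **THEOREM 20'S CANCELLATION FROM THE POLYCHOTOMY** (measure half = ★ (T20-e1) in the direction that occurs): with `μ` a left Haar measure on `G`, `K′` compact open,
the `U_c` CLOSED with left-invariant measures `ν_c` on `↥U_c` (positive on opens, finite on compacts, s-finite), `f` continuous and a cusp form along EVERY `U_c`
(`∫ f(x u) dν_c(u) = 0` for all `x`), and the polychotomy conclusion at `z`: `∫_{k ∈ K′} f(z k) dμ = 0`.
[cite: HarishChandra1970, Part VII §8 Lemmas 53 and 57, pp. 81–84] [cite: Folland1995, §2.4] -/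
theorem setIntegral_mul_eq_zero_of_polychotomy_haar {ι : Type*} (μ : Measure G) [μ.IsHaarMeasure] (K' : Subgroup G) (U : ι → Subgroup G)
    (ν : (c : ι) → Measure ↥(U c)) [∀ c, SFinite (ν c)] [∀ c, (ν c).IsOpenPosMeasure] [∀ c, IsFiniteMeasureOnCompacts (ν c)]
    [∀ c, (ν c).IsMulLeftInvariant]
    (hU : ∀ c, IsClosed ((U c : Subgroup G) : Set G)) (hK'o : IsOpen (K' : Set G)) (hK'c : IsCompact (K' : Set G))
    (f : G → E) (hf : Continuous f) (hcusp : ∀ c, ∀ x : G, ∫ u : ↥(U c), f (x * ↑u) ∂(ν c) = 0)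
    {z : G}
    (hpoly : (∀ k ∈ K', f (z * k) = 0) ∨
      ∃ c, ∀ k ∈ K', ∃ g₀ : G, ∃ u₀ ∈ U c, z * k = g₀ * u₀ ∧ ∀ u ∈ U c, f (g₀ * u) ≠ 0 → u ∈ K') :
    ∫ k in (K' : Set G), f (z * k) ∂μ = 0 := by
  rcases hpoly with h0 | ⟨c, hk⟩
  · exact setIntegral_mul_eq_zero_of_forall_eq_zero μ K' f h0
  · exact setIntegral_mul_eq_zero_of_cuspForm μ (U c) K' (ν c) (hU c) hK'o hK'c hK'c.measure_lt_top
      (fun _ hk' => Literature.NumberTheory.Automorphic.map_mul_right_eq_self_of_mem_isCompact μ hK'c hk') f hf (hcusp c) hk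

/-- **THEOREM 20 FOR A FINITE FAMILY OF CONTRACTING DIRECTIONS, AT THE CONJUGATE LEVEL `K′ = K₀(y⁻¹) = K₀ ∩ y⁻¹K₀y`** (= §2 ∘ §3 with `S = {f ≠ 0}`,
`j₀ := m + 2s`, membership `k ∈ K′ ↔ k ∈ K₀ ∧ y k y⁻¹ ∈ K₀`, the deep containment `L (m+2s) ≤ K′` fed as ★ (T20-c) does): for `y ∈ Ω s` and
`x ∉ Ω (m_C + R + s)`, **`∫_{k ∈ K′} f(x y k) dμ(k) = 0`** — the higher-rank Theorem 20 with every structural hypothesis explicit (instantiated at `GL₃(F)` by FILE (B)).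
[cite: HarishChandra1970, Part VII §2 Theorem 20 p. 70; §8 pp. 80–84] [cite: Casselman1995, Prop. 1.4.3–1.4.4] -/
theorem cuspForm_cancellation_polychotomy_conjLevel {ι : Type*} (μ : Measure G) [μ.IsHaarMeasure] (Ω : ℕ → Set G)
    (hΩmul : ∀ {a b : ℕ} {g g' : G}, g ∈ Ω a → g' ∈ Ω b → g * g' ∈ Ω (a + b)) (hΩinv : ∀ {a : ℕ} {g : G}, g ∈ Ω a → g⁻¹ ∈ Ω a)
    (K₀ K' A : Subgroup G) (T U V : ι → Subgroup G) (P : ι → Set G) (D : ι → ℕ) (L : ℕ → Subgroup G)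
    (ν : (c : ι) → Measure ↥(U c)) [∀ c, SFinite (ν c)] [∀ c, (ν c).IsOpenPosMeasure] [∀ c, IsFiniteMeasureOnCompacts (ν c)]
    [∀ c, (ν c).IsMulLeftInvariant]
    (hK₀ : (K₀ : Set G) ⊆ Ω 0) {m s : ℕ} {y : G} (hy : y ∈ Ω s)
    (hK' : ∀ k, k ∈ K' ↔ k ∈ K₀ ∧ y * k * y⁻¹ ∈ K₀) (hdeep : ∀ u ∈ L (m + 2 * s), u ∈ K₀ ∧ y * u * y⁻¹ ∈ K₀)
    (hK'o : IsOpen (K' : Set G)) (hK'c : IsCompact (K' : Set G)) (hU : ∀ c, IsClosed ((U c : Subgroup G) : Set G))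
    (f : G → E) (hf : Continuous f) (C : Set G) {mC : ℕ} (hC : C ⊆ Ω mC) (hsupp : ∀ g, f g ≠ 0 → g ∈ C * (A : Set G))
    (hcusp : ∀ c, ∀ x : G, ∫ u : ↥(U c), f (x * ↑u) ∂(ν c) = 0) {R : ℕ}
    (hcover : ∀ a ∈ A, a ∉ Ω R → ∃ c, a ∈ P c)
    (hIw : ∀ c, ∀ k ∈ K₀, ∃ v ∈ K₀ ⊓ V c, ∃ t ∈ K₀ ⊓ T c, ∃ u ∈ K₀ ⊓ U c, k = v * t * u)
    (h54 : ∀ c, ∀ u ∈ U c, ∀ a' ∈ A, ∀ k : ℕ, u * a' ∈ Ω k → u ∈ Ω (2 * k))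
    (hV : ∀ c, ∀ a ∈ P c, ∀ v ∈ K₀ ⊓ V c, a * v * a⁻¹ ∈ K₀)
    (hT : ∀ c, ∀ a ∈ P c, ∀ t ∈ K₀ ⊓ T c, a * t * a⁻¹ ∈ Ω (D c))
    (hnormU : ∀ c, ∀ a ∈ P c, ∀ u ∈ U c, a * u * a⁻¹ ∈ U c)
    (hcontr : ∀ c, ∀ a ∈ P c, ∀ (k j : ℕ), j + k ≤ m + 2 * s + (4 * mC + 2 * D c) + 1 → ∀ u ∈ U c, u ∈ Ω k → a⁻¹ * u * a ∈ L j)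
    {x : G} (hx : x ∉ Ω (mC + R + s)) :
    ∫ k in (K' : Set G), f (x * y * k) ∂μ = 0 := by
  have hK'le : K' ≤ K₀ := fun k hk => ((hK' k).1 hk).1
  have hL : L (m + 2 * s) ≤ K' := fun u hu => (hK' u).2 (hdeep u hu)
  exact setIntegral_mul_eq_zero_of_polychotomy_haar μ K' U ν hU hK'o hK'c f hf hcusp
    (cuspForm_polychotomy_support Ω hΩmul hΩinv K₀ K' A T U V P D L hK₀ hK'le hL f C hC hsupp hcover hIw h54 hV hT hnormU hcontr hy hx)

end Measure

end Summit.HodgeConjecture.HodgeConjecture.Cruxes.H413.K2E3CuspFormCancellationPolychotomy
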